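import Mathlib.LinearAlgebra.Matrix.Determinant.Basic
import Mathlib.LinearAlgebra.Matrix.SchurComplement
import Mathlib.Tactic.FieldSimp
import Mathlib.Tactic.Positivity
import Mathlib.GroupTheory.Perm.Cycle.Type
import Mathlib.GroupTheory.Perm.Cycle.Concrete
import Mathlib.Dynamics.PeriodicPts.Defs
import Literature.Barriers.ValiantsHypothesis.MonotoneGap
import HarnessLib

/-!
# The directed matrix-tree theorem for the spanning tree polynomial `ST` (Tutte; Moon 1970)

Jerrum–Snir (J. ACM 29 (1982), §5.1, p. 893) invoke, for the general-circuit side of the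
monotone gap, that "if negative constants are allowed, the same polynomial `ST_{n×n}` can be
expressed as an `n × n` determinant whose elements are linear combinations of the
indeterminates [13]" (`[13]` = J. W. Moon, *Counting Labelled Trees*, 1970, where the count
`|mon(ST_{n×n})| = n^{n-2}` of §4.5, p. 892 is also taken from). This file proves that
determinant identity for the tree's rendering `stPoly R N` of `ST` (`MonotoneGap.lean`: root
`none`, non-root nodes `Fin N`, variables `x_{(i,v)}`, `i : Fin N`, `v : Option (Fin N)`), over an
arbitrary commutative ring `R`:

* `stLaplacian R N` — the reduced Kirchhoff (Laplacian) matrix of the complete digraph on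
  `Option (Fin N)` with generic edge weights, rows and columns indexed by the non-root nodes:
  diagonal entry `(i,i)` = `Σ_{v ≠ some i} x_{(i,v)}` (all edges out of `i`, including the edge
  to the root), off-diagonal entry `(i,j)` = `-x_{(i, some j)}`.
* `det_stLaplacian : (stLaplacian R N).det = stPoly R N` — the directed (arborescence) form of
  the matrix-tree theorem for the complete graph.

## Proof

The standard sign-reversing-involution proof (Chaiken / Zeilberger style), carried out on the
Leibniz expansion. Expanding `det` over permutations `σ` of `Fin N` and each diagonal entry over
its summands writes `det L = Σ_t (Σ_{σ compatible with t} (-1)^{c(σ)}) · Π_i x_{(i, t i)}`, where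
`t : Fin N → Option (Fin N)` ranges over all parent maps, `σ` is *compatible* with `t` when `t`
follows `σ` on the support of `σ` and has no loop at the fixed points of `σ`
(`Compatible`), and `c(σ)` is the number of cycles of `σ` (`sign σ · (-1)^{#supp σ} = (-1)^{c(σ)}`,
`sign_mul_neg_one_pow`). For an arborescence `t` only `σ = 1` is compatible
(`Compatible.eq_one`); for a parent map with a loop nothing is compatible; for a loop-free
non-arborescence `t` the successor map `succMap t` has a periodic point off its fixed points
(`exists_periodicPt`), such a point `j` determines a cycle `orbitPerm t j` (the
`List.formPerm` of its orbit), and `σ ↦ σ · c^{∓1}` (remove the cycle if `σ` moves its base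
point, insert it otherwise) is a sign-reversing involution on the compatible permutations
(`sum_compatible_eq_zero`), so the inner sum vanishes.

## References

* [JerrumSnir1982] M. Jerrum, M. Snir, J. ACM 29 (1982) 874–897, §4.5 (p. 892, `|mon(p)| =
  n^{n-2}` [13]) and §5.1 (p. 893, `ST` as an `n × n` determinant [13]).
* [Moon1970] J. W. Moon, *Counting Labelled Trees*, Canadian Mathematical Monographs 1,
  Canadian Mathematical Congress, Montreal, 1970 (the matrix-tree theorem for rooted directed
  trees, §5).
-/

noncomputable section

namespace Literature.Barriers.ValiantsHypothesis

open MvPolynomial Finset Equiv Function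

universe u

/-! ### The reduced Laplacian and its Leibniz expansion -/

section Laplacian

variable (R : Type u) [CommRing R] (N : ℕ)

/-- The reduced Kirchhoff/Laplacian matrix of the complete digraph on the nodes `Option (Fin N)`
(root `none`) with generic edge weights `x_{(i,v)}` (edge from the non-root node `i` to the node
`v`), restricted to the non-root nodes: `L i i = Σ_{v ≠ some i} x_{(i,v)}`,
`L i j = -x_{(i, some j)}` for `i ≠ j` — the "`n × n` determinant whose elements are linear
combinations of the indeterminates" of Jerrum–Snir §5.1. [cite: JerrumSnir1982, §5.1] -/
def stLaplacian : Matrix (Fin N) (Fin N) (MvPolynomial (Fin N × Option (Fin N)) R) :=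
  Matrix.of fun i j => if i = j then ∑ v ∈ univ.erase (some i), X (i, v) else -X (i, some j)

variable {R N}

/-- Diagonal entries of the reduced Laplacian. [cite: JerrumSnir1982, §5.1] -/
theorem stLaplacian_apply_self (i : Fin N) :
    stLaplacian R N i i = ∑ v ∈ univ.erase (some i), X (i, v) := by
  simp [stLaplacian]

/-- Off-diagonal entries of the reduced Laplacian. [cite: JerrumSnir1982, §5.1] -/
theorem stLaplacian_apply_of_ne {i j : Fin N} (h : i ≠ j) :
    stLaplacian R N i j = -X (i, some j) := by
  simp [stLaplacian, h]

/-- A permutation `σ` of the non-root nodes is *compatible* with a parent map `t` if `t` follows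
`σ` on the support of `σ` and has no loop at the fixed points of `σ` (the pairs `(σ, t)` index
the fully expanded Leibniz formula for `det (stLaplacian R N)`). [folklore] -/
def Compatible (σ : Perm (Fin N)) (t : Fin N → Option (Fin N)) : Prop :=
  ∀ i, (σ i = i → t i ≠ some i) ∧ (σ i ≠ i → t i = some (σ i))

/-- Compatibility is decidable (a finite conjunction of decidable conditions). [folklore] -/
instance (σ : Perm (Fin N)) (t : Fin N → Option (Fin N)) : Decidable (Compatible σ t) := by
  unfold Compatible; infer_instance

/-- The targets allowed for node `i` in a parent map compatible with `σ`. [folklore] -/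
def compatTargets (σ : Perm (Fin N)) (i : Fin N) : Finset (Option (Fin N)) :=
  if σ i = i then univ.erase (some i) else {some (σ i)}

/-- Compatibility is membership in the box `Π_i compatTargets σ i`. [folklore] -/
theorem mem_piFinset_allowed {σ : Perm (Fin N)} {t : Fin N → Option (Fin N)} :
    t ∈ Fintype.piFinset (compatTargets σ) ↔ Compatible σ t := by
  rw [Fintype.mem_piFinset]
  refine forall_congr' fun i => ?_
  unfold compatTargets
  by_cases h : σ i = i <;> simp [h]

variable (R) in
/-- Row `i` of the Laplacian at column `σ i`, as a sum over the allowed targets. [folklore] -/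
theorem stLaplacian_apply_perm (σ : Perm (Fin N)) (i : Fin N) :
    stLaplacian R N i (σ i) =
      ∑ v ∈ compatTargets σ i, (if σ i = i then (1 : MvPolynomial _ R) else -1) * X (i, v) := by
  unfold compatTargets
  by_cases h : σ i = i
  · rw [h, stLaplacian_apply_self]
    simp
  · rw [stLaplacian_apply_of_ne (Ne.symm h)]
    simp [h]

variable (R) in
/-- The Leibniz term of `σ`, fully expanded: `Π_i L i (σ i) = (-1)^{#supp σ} Σ_{t compatible} Π_i x_{(i, t i)}`.
[folklore] -/
theorem prod_stLaplacian_perm (σ : Perm (Fin N)) :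
    ∏ i, stLaplacian R N i (σ i) =
      (-1) ^ σ.support.card * ∑ t ∈ Fintype.piFinset (compatTargets σ), ∏ i, X (i, t i) := by
  simp_rw [stLaplacian_apply_perm R σ]
  rw [Finset.prod_univ_sum, Finset.mul_sum]
  refine Finset.sum_congr rfl fun t _ => ?_
  rw [Finset.prod_mul_distrib]
  congr 1
  rw [Finset.prod_ite, Finset.prod_const_one, one_mul, Finset.prod_const]
  rfl

/-- `sign σ · (-1)^{#supp σ} = (-1)^{c(σ)}`, `c(σ)` the number of cycles of `σ`: a cycle of length
`ℓ` has sign `(-1)^{ℓ-1}`. [folklore] -/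
theorem sign_mul_neg_one_pow {A : Type*} [CommRing A] (σ : Perm (Fin N)) :
    ((Perm.sign σ : ℤ) : A) * (-1) ^ σ.support.card = (-1) ^ σ.cycleFactorsFinset.card := by
  have hcard : Multiset.card σ.cycleType = σ.cycleFactorsFinset.card := by
    rw [Perm.cycleType_def, Multiset.card_map]; rfl
  rw [Perm.sign_of_cycleType, Perm.sum_cycleType, hcard, Units.val_pow_eq_pow_val, Units.val_neg,
    Units.val_one, Int.cast_pow, Int.cast_neg, Int.cast_one, ← pow_add]
  rw [show σ.support.card + σ.cycleFactorsFinset.card + σ.support.card =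
      2 * σ.support.card + σ.cycleFactorsFinset.card by ring, pow_add, pow_mul]
  simp

variable (R N) in
/-- **Leibniz expansion of the reduced Laplacian, regrouped by parent maps**:
`det L = Σ_t (Σ_{σ compatible with t} (-1)^{c(σ)}) · Π_i x_{(i, t i)}`. [folklore] -/
theorem det_stLaplacian_eq_sum :
    (stLaplacian R N).det = ∑ t : Fin N → Option (Fin N),
      (∑ σ ∈ univ.filter (Compatible · t), (-1 : MvPolynomial _ R) ^ σ.cycleFactorsFinset.card) *
        ∏ i, X (i, t i) := by
  rw [← Matrix.det_transpose, Matrix.det_apply']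
  simp only [Matrix.transpose_apply]
  simp_rw [prod_stLaplacian_perm R, ← mul_assoc, sign_mul_neg_one_pow, Finset.mul_sum]
  -- exchange the two summations
  have h : ∀ σ : Perm (Fin N),
      ∑ t ∈ Fintype.piFinset (compatTargets σ), (-1 : MvPolynomial _ R) ^ σ.cycleFactorsFinset.card *
          ∏ i, X (i, t i) =
        ∑ t : Fin N → Option (Fin N), if Compatible σ t then
          (-1 : MvPolynomial _ R) ^ σ.cycleFactorsFinset.card * ∏ i, X (i, t i) else 0 := by
    intro σ
    rw [← Finset.sum_filter]
    refine Finset.sum_congr ?_ fun _ _ => rfl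
    ext t
    simp only [Finset.mem_filter, Finset.mem_univ, true_and]
    exact mem_piFinset_allowed
  simp_rw [h]
  rw [Finset.sum_comm]
  refine Finset.sum_congr rfl fun t _ => ?_
  rw [Finset.sum_mul, ← Finset.sum_filter]

end Laplacian

/-! ### The successor map of a parent map and its periodic points -/

section Succ

variable {N : ℕ}

/-- The successor map of a parent map on the non-root nodes: `i ↦ t i`, and `i ↦ i` when `t i`
is the root. [folklore] -/
def succMap (t : Fin N → Option (Fin N)) (i : Fin N) : Fin N :=
  (t i).getD i

variable {t : Fin N → Option (Fin N)}

/-- If `t i = some v` then the successor of `i` is `v`. [folklore] -/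
theorem succMap_of_eq_some {i v : Fin N} (h : t i = some v) : succMap t i = v := by
  simp [succMap, h]

/-- If `t i` is the root then `i` is fixed by the successor map. [folklore] -/
theorem succMap_of_eq_none {i : Fin N} (h : t i = none) : succMap t i = i := by
  simp [succMap, h]

/-- A node moved by the successor map points to its successor. [folklore] -/
theorem eq_some_succMap_of_ne {i : Fin N} (h : succMap t i ≠ i) : t i = some (succMap t i) := by
  cases hi : t i with
  | none => exact absurd (succMap_of_eq_none hi) h
  | some v => rw [succMap_of_eq_some hi]

/-- For a loop-free parent map, the fixed points of the successor map are exactly the nodes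
attached to the root. [folklore] -/
theorem succMap_eq_self_iff (hloop : ∀ i, t i ≠ some i) {i : Fin N} :
    succMap t i = i ↔ t i = none := by
  refine ⟨fun h => ?_, succMap_of_eq_none⟩
  cases hi : t i with
  | none => rfl
  | some v =>
    exfalso
    rw [succMap_of_eq_some hi] at h
    exact hloop i (hi.trans (congrArg some h))

/-- Iterating the parent map from `some i` either has reached the root or sits at the iterated
successor. [folklore] -/
theorem iterate_parentMap_eq_or (i : Fin N) (r : ℕ) :
    (parentMap t)^[r] (some i) = none ∨ (parentMap t)^[r] (some i) = some ((succMap t)^[r] i) := by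
  induction r with
  | zero => exact Or.inr rfl
  | succ r ih =>
    rw [Function.iterate_succ_apply', Function.iterate_succ_apply']
    rcases ih with h | h
    · exact Or.inl (by rw [h, parentMap_none])
    · rw [h, parentMap_some]
      cases ht : t ((succMap t)^[r] i) with
      | none => exact Or.inl rfl
      | some v => exact Or.inr (by rw [succMap_of_eq_some ht])

/-- A permutation compatible with `t` agrees with the successor map on its support. [folklore] -/
theorem Compatible.succMap_eq {σ : Perm (Fin N)} (hc : Compatible σ t) {i : Fin N} (hi : σ i ≠ i) :
    succMap t i = σ i :=
  succMap_of_eq_some ((hc i).2 hi)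

/-- The support of a permutation is closed under the permutation. [folklore] -/
theorem perm_apply_ne_of_ne {σ : Perm (Fin N)} {i : Fin N} (hi : σ i ≠ i) : σ (σ i) ≠ σ i :=
  fun h => hi (σ.injective h)

/-- On the support of a compatible permutation the iterated successor map is the iterated
permutation, and stays in the support. [folklore] -/
theorem Compatible.iterate_succMap_eq {σ : Perm (Fin N)} (hc : Compatible σ t) {i : Fin N}
    (hi : σ i ≠ i) (n : ℕ) : (succMap t)^[n] i = (σ ^ n) i ∧ σ ((succMap t)^[n] i) ≠ (succMap t)^[n] i := by
  induction n with
  | zero => exact ⟨rfl, hi⟩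
  | succ n ih =>
    rw [Function.iterate_succ_apply', pow_succ', Perm.mul_apply, hc.succMap_eq ih.2, ih.1]
    exact ⟨rfl, perm_apply_ne_of_ne (ih.1 ▸ ih.2)⟩

/-- **Only the identity is compatible with an arborescence**: a moved point would never reach the
root. [folklore] -/
theorem Compatible.eq_one {σ : Perm (Fin N)} (hc : Compatible σ t) (ht : IsArborescence t) :
    σ = 1 := by
  by_contra hne
  obtain ⟨i, hi⟩ : ∃ i, σ i ≠ i := not_forall.1 fun h => hne (Equiv.ext h)
  -- the walk from `i` follows `σ`, so it never reaches the root
  have key : ∀ r, (parentMap t)^[r] (some i) = some ((succMap t)^[r] i) := by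
    intro r
    induction r with
    | zero => rfl
    | succ r ih =>
      have hmv := (hc.iterate_succMap_eq hi r).2
      rw [Function.iterate_succ_apply', ih, parentMap_some, (hc _).2 hmv, ← hc.succMap_eq hmv,
        Function.iterate_succ_apply']
  obtain ⟨r, hr⟩ := ht i
  rw [key r] at hr
  exact Option.some_ne_none _ hr

/-- The identity is compatible exactly with the loop-free parent maps. [folklore] -/
theorem compatible_one_iff : Compatible 1 t ↔ ∀ i, t i ≠ some i := by
  simp [Compatible]

/-- A parent map with a loop admits no compatible permutation. [folklore] -/
theorem not_compatible_of_loop {σ : Perm (Fin N)} {i : Fin N} (h : t i = some i) :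
    ¬ Compatible σ t := by
  intro hc
  by_cases hi : σ i = i
  · exact (hc i).1 hi h
  · exact hi (Option.some_injective _ (((hc i).2 hi).symm.trans h))

/-- **A loop-free parent map that is not an arborescence has a periodic point of the successor
map which is not a fixed point** (pigeonhole along a walk that never reaches the root).
[folklore] -/
theorem exists_periodicPt (hloop : ∀ i, t i ≠ some i) (ht : ¬ IsArborescence t) :
    ∃ j, j ∈ periodicPts (succMap t) ∧ succMap t j ≠ j := by
  simp only [IsArborescence, not_forall, not_exists] at ht
  obtain ⟨i, hi⟩ := ht
  have hwalk : ∀ r, (parentMap t)^[r] (some i) = some ((succMap t)^[r] i) := fun r =>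
    (iterate_parentMap_eq_or i r).resolve_left (hi r)
  have hnofix : ∀ r, succMap t ((succMap t)^[r] i) ≠ (succMap t)^[r] i := by
    intro r h
    rw [succMap_eq_self_iff hloop] at h
    have := hwalk (r + 1)
    rw [Function.iterate_succ_apply', hwalk r, parentMap_some, h] at this
    exact Option.some_ne_none _ this.symm
  obtain ⟨a, b, hab, h⟩ := Finite.exists_ne_map_eq_of_infinite fun n : ℕ => (succMap t)^[n] i
  wlog hlt : a < b generalizing a b
  · exact this b a hab.symm h.symm (lt_of_le_of_ne (not_lt.1 hlt) hab.symm)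
  refine ⟨(succMap t)^[a] i, mk_mem_periodicPts (Nat.sub_pos_of_lt hlt) ?_, hnofix a⟩
  change (succMap t)^[b - a] ((succMap t)^[a] i) = (succMap t)^[a] i
  rw [← Function.iterate_add_apply, Nat.sub_add_cancel hlt.le]
  exact h.symm

end Succ

/-! ### The canonical cycle of a bad parent map and the sign-reversing involution -/

section Involution

variable {N : ℕ} {t : Fin N → Option (Fin N)}

open Classical in
/-- The periodic points of the successor map that are not fixed. [folklore] -/
def badPts (t : Fin N → Option (Fin N)) : Finset (Fin N) :=
  univ.filter fun j => j ∈ periodicPts (succMap t) ∧ succMap t j ≠ j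

/-- The orbit of `j` under the successor map, listed once around. [folklore] -/
def orbitList (t : Fin N → Option (Fin N)) (j : Fin N) : List (Fin N) :=
  (List.range (minimalPeriod (succMap t) j)).map fun n => (succMap t)^[n] j

/-- The orbit list has no duplicates. [folklore] -/
theorem nodup_orbitList (j : Fin N) : (orbitList t j).Nodup := by
  have h := nodup_periodicOrbit (f := succMap t) (x := j)
  rwa [periodicOrbit_def, Cycle.nodup_coe_iff] at h

/-- Length of the orbit list. [folklore] -/
theorem length_orbitList (j : Fin N) : (orbitList t j).length = minimalPeriod (succMap t) j := by
  simp [orbitList]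

/-- Membership in the orbit list of a periodic point. [folklore] -/
theorem mem_orbitList_iff {j : Fin N} (hj : j ∈ periodicPts (succMap t)) {y : Fin N} :
    y ∈ orbitList t j ↔ ∃ n, (succMap t)^[n] j = y := by
  rw [← mem_periodicOrbit_iff hj, periodicOrbit_def]
  rfl

/-- The cyclic permutation of the orbit of `j`. [folklore] -/
def orbitPerm (t : Fin N → Option (Fin N)) (j : Fin N) : Perm (Fin N) :=
  (orbitList t j).formPerm

/-- On the orbit, the orbit permutation is the successor map. [folklore] -/
theorem orbitPerm_apply_of_mem {j y : Fin N} (hy : y ∈ orbitList t j) :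
    orbitPerm t j y = succMap t y := by
  obtain ⟨n, hn, rfl⟩ := List.getElem_of_mem hy
  unfold orbitPerm
  rw [List.formPerm_apply_getElem _ (nodup_orbitList j)]
  simp only [orbitList, List.getElem_map, List.getElem_range, List.length_map, List.length_range]
  rw [iterate_mod_minimalPeriod_eq, Function.iterate_succ_apply']

/-- Off the orbit, the orbit permutation is the identity. [folklore] -/
theorem orbitPerm_apply_of_not_mem {j y : Fin N} (hy : y ∉ orbitList t j) : orbitPerm t j y = y :=
  List.formPerm_apply_of_notMem hy

/-- A bad point has minimal period at least `2`. [folklore] -/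
theorem two_le_minimalPeriod {j : Fin N} (hj : j ∈ periodicPts (succMap t)) (hfix : succMap t j ≠ j) :
    2 ≤ minimalPeriod (succMap t) j := by
  have h1 : 0 < minimalPeriod (succMap t) j := minimalPeriod_pos_of_mem_periodicPts hj
  have h2 : minimalPeriod (succMap t) j ≠ 1 := by
    rw [Ne, minimalPeriod_eq_one_iff_isFixedPt]; exact hfix
  omega

/-- The orbit permutation of a bad point is a cycle. [folklore] -/
theorem isCycle_orbitPerm {j : Fin N} (hj : j ∈ periodicPts (succMap t)) (hfix : succMap t j ≠ j) :
    (orbitPerm t j).IsCycle :=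
  List.isCycle_formPerm (nodup_orbitList j) (by rw [length_orbitList]; exact two_le_minimalPeriod hj hfix)

/-- The support of the orbit permutation of a bad point is the orbit. [folklore] -/
theorem support_orbitPerm {j : Fin N} (hj : j ∈ periodicPts (succMap t)) (hfix : succMap t j ≠ j) :
    (orbitPerm t j).support = (orbitList t j).toFinset := by
  refine List.support_formPerm_of_nodup _ (nodup_orbitList j) fun x hx => ?_
  have h := two_le_minimalPeriod hj hfix
  rw [← length_orbitList (t := t), hx] at h
  simp at h

/-- The orbit is closed under the successor map. [folklore] -/
theorem succMap_mem_orbitList {j : Fin N} (hj : j ∈ periodicPts (succMap t)) {y : Fin N}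
    (hy : y ∈ orbitList t j) : succMap t y ∈ orbitList t j := by
  rw [mem_orbitList_iff hj] at hy ⊢
  obtain ⟨n, rfl⟩ := hy
  exact ⟨n + 1, by rw [Function.iterate_succ_apply']⟩

/-- Every point of the orbit returns to the base point. [folklore] -/
theorem exists_iterate_eq_base {j : Fin N} (hj : j ∈ periodicPts (succMap t)) {y : Fin N}
    (hy : y ∈ orbitList t j) : ∃ m, (succMap t)^[m] y = j := by
  rw [mem_orbitList_iff hj] at hy
  obtain ⟨n, rfl⟩ := hy
  refine ⟨minimalPeriod (succMap t) j - n % minimalPeriod (succMap t) j, ?_⟩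
  have hp := minimalPeriod_pos_of_mem_periodicPts hj
  rw [← iterate_mod_minimalPeriod_eq (n := n), ← Function.iterate_add_apply,
    Nat.sub_add_cancel (Nat.mod_lt _ hp).le, iterate_minimalPeriod]

variable {σ : Perm (Fin N)}

/-- If a compatible permutation moves a point, its whole forward orbit under the successor map
consists of moved points. [folklore] -/
theorem Compatible.iterate_ne (hc : Compatible σ t) {i : Fin N} (hi : σ i ≠ i) (n : ℕ) :
    σ ((succMap t)^[n] i) ≠ (succMap t)^[n] i :=
  (hc.iterate_succMap_eq hi n).2

/-- If a compatible permutation moves the base point, it moves the whole orbit and agrees there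
with the orbit permutation. [folklore] -/
theorem Compatible.apply_eq_orbitPerm (hc : Compatible σ t) {j : Fin N}
    (hj : j ∈ periodicPts (succMap t)) (hσj : σ j ≠ j) {y : Fin N} (hy : y ∈ orbitList t j) :
    σ y ≠ y ∧ orbitPerm t j y = σ y := by
  have hy' := hy
  rw [mem_orbitList_iff hj] at hy'
  obtain ⟨n, rfl⟩ := hy'
  exact ⟨hc.iterate_ne hσj n, by rw [orbitPerm_apply_of_mem hy, hc.succMap_eq (hc.iterate_ne hσj n)]⟩

/-- If a compatible permutation fixes the base point, it fixes the whole orbit. [folklore] -/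
theorem Compatible.apply_eq_self_of_mem (hc : Compatible σ t) {j : Fin N}
    (hj : j ∈ periodicPts (succMap t)) (hσj : σ j = j) {y : Fin N} (hy : y ∈ orbitList t j) :
    σ y = y := by
  by_contra hy'
  obtain ⟨m, hm⟩ := exists_iterate_eq_base hj hy
  exact hc.iterate_ne hy' m (by rw [hm, hσj])

/-- Case "base point moved": the orbit permutation is one of the cycles of `σ`. [folklore] -/
theorem Compatible.orbitPerm_mem_cycleFactorsFinset (hc : Compatible σ t) {j : Fin N}
    (hj : j ∈ periodicPts (succMap t)) (hfix : succMap t j ≠ j) (hσj : σ j ≠ j) :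
    orbitPerm t j ∈ σ.cycleFactorsFinset := by
  rw [Perm.mem_cycleFactorsFinset_iff]
  refine ⟨isCycle_orbitPerm hj hfix, fun a ha => ?_⟩
  rw [support_orbitPerm hj hfix, List.mem_toFinset] at ha
  exact (hc.apply_eq_orbitPerm hj hσj ha).2

/-- Case "base point fixed": the orbit permutation is disjoint from `σ`. [folklore] -/
theorem Compatible.disjoint_orbitPerm (hc : Compatible σ t) {j : Fin N}
    (hj : j ∈ periodicPts (succMap t)) (hσj : σ j = j) : Perm.Disjoint σ (orbitPerm t j) := by
  intro y
  by_cases hy : y ∈ orbitList t j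
  · exact Or.inl (hc.apply_eq_self_of_mem hj hσj hy)
  · exact Or.inr (orbitPerm_apply_of_not_mem hy)

/-- The toggle: remove the canonical cycle if `σ` moves its base point, insert it otherwise.
[folklore] -/
def toggle (t : Fin N → Option (Fin N)) (j : Fin N) (σ : Perm (Fin N)) : Perm (Fin N) :=
  if σ j = j then σ * orbitPerm t j else σ * (orbitPerm t j)⁻¹

/-- Inserting the cycle moves the base point. [folklore] -/
theorem toggle_apply_base_of_eq (hc : Compatible σ t) {j : Fin N} (hj : j ∈ periodicPts (succMap t))
    (hfix : succMap t j ≠ j) (hσj : σ j = j) : (σ * orbitPerm t j) j ≠ j := by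
  have hjmem : j ∈ orbitList t j := (mem_orbitList_iff hj).2 ⟨0, rfl⟩
  rw [Perm.mul_apply, orbitPerm_apply_of_mem hjmem,
    hc.apply_eq_self_of_mem hj hσj (succMap_mem_orbitList hj hjmem)]
  exact hfix

/-- Removing the cycle fixes the base point (indeed the whole orbit). [folklore] -/
theorem toggle_apply_of_ne (hc : Compatible σ t) {j : Fin N} (hj : j ∈ periodicPts (succMap t))
    (hσj : σ j ≠ j) {y : Fin N} (hy : y ∈ orbitList t j) : (σ * (orbitPerm t j)⁻¹) y = y := by
  rw [Perm.mul_apply]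
  set z := (orbitPerm t j)⁻¹ y with hz
  have hzy : orbitPerm t j z = y := by rw [hz]; exact (orbitPerm t j).apply_symm_apply y
  have hzmem : z ∈ orbitList t j := by
    by_contra h
    rw [orbitPerm_apply_of_not_mem h] at hzy
    exact h (hzy ▸ hy)
  rw [← (hc.apply_eq_orbitPerm hj hσj hzmem).2, hzy]

/-- The toggle preserves compatibility. [folklore] -/
theorem Compatible.toggle (hc : Compatible σ t) {j : Fin N} (hj : j ∈ periodicPts (succMap t))
    (hfix : succMap t j ≠ j) : Compatible (toggle t j σ) t := by
  unfold ValiantsHypothesis.toggle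
  split_ifs with hσj
  · intro i
    by_cases hi : i ∈ orbitList t j
    · have hval : (σ * orbitPerm t j) i = succMap t i := by
        rw [Perm.mul_apply, orbitPerm_apply_of_mem hi,
          hc.apply_eq_self_of_mem hj hσj (succMap_mem_orbitList hj hi)]
      have hne : succMap t i ≠ i := by
        rw [mem_orbitList_iff hj] at hi
        obtain ⟨n, rfl⟩ := hi
        intro h
        have := minimalPeriod_apply_iterate hj n
        rw [(minimalPeriod_eq_one_iff_isFixedPt).2 h] at this
        have h2 := two_le_minimalPeriod hj hfix
        omega
      rw [hval]
      exact ⟨fun h => absurd h hne, fun _ => eq_some_succMap_of_ne hne⟩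
    · have hval : (σ * orbitPerm t j) i = σ i := by
        rw [Perm.mul_apply, orbitPerm_apply_of_not_mem hi]
      rw [hval]
      exact hc i
  · intro i
    by_cases hi : i ∈ orbitList t j
    · rw [toggle_apply_of_ne hc hj hσj hi]
      refine ⟨fun _ h => ?_, fun h => absurd rfl h⟩
      exact not_compatible_of_loop h hc
    · have hval : (σ * (orbitPerm t j)⁻¹) i = σ i := by
        rw [Perm.mul_apply]
        congr 1
        rw [Perm.inv_eq_iff_eq]
        exact (orbitPerm_apply_of_not_mem hi).symm
      rw [hval]
      exact hc i

/-- The toggle is an involution on compatible permutations. [folklore] -/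
theorem Compatible.toggle_toggle (hc : Compatible σ t) {j : Fin N} (hj : j ∈ periodicPts (succMap t))
    (hfix : succMap t j ≠ j) : ValiantsHypothesis.toggle t j (ValiantsHypothesis.toggle t j σ) = σ := by
  unfold ValiantsHypothesis.toggle
  split_ifs with h1 h2 h2
  · exact absurd h2 (toggle_apply_base_of_eq hc hj hfix h1)
  · rw [mul_inv_cancel_right]
  · rw [inv_mul_cancel_right]
  · exact absurd (toggle_apply_of_ne hc hj h1 ((mem_orbitList_iff hj).2 ⟨0, rfl⟩)) h2

/-- The toggle changes the number of cycles by one, hence reverses the sign. [folklore] -/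
theorem Compatible.neg_one_pow_toggle {A : Type*} [CommRing A] (hc : Compatible σ t) {j : Fin N}
    (hj : j ∈ periodicPts (succMap t)) (hfix : succMap t j ≠ j) :
    (-1 : A) ^ (ValiantsHypothesis.toggle t j σ).cycleFactorsFinset.card =
      -(-1 : A) ^ σ.cycleFactorsFinset.card := by
  unfold ValiantsHypothesis.toggle
  split_ifs with hσj
  · have hd := hc.disjoint_orbitPerm hj hσj
    rw [hd.cycleFactorsFinset_mul_eq_union, Finset.card_union_of_disjoint hd.disjoint_cycleFactorsFinset,
      (isCycle_orbitPerm hj hfix).cycleFactorsFinset_eq_singleton, Finset.card_singleton, pow_succ]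
    ring
  · have hmem := hc.orbitPerm_mem_cycleFactorsFinset hj hfix hσj
    rw [Perm.cycleFactorsFinset_mul_inv_mem_eq_sdiff hmem, Finset.card_sdiff_of_subset
      (Finset.singleton_subset_iff.2 hmem), Finset.card_singleton]
    have hpos : 1 ≤ σ.cycleFactorsFinset.card := Finset.card_pos.2 ⟨_, hmem⟩
    conv_rhs => rw [← Nat.sub_add_cancel hpos, pow_succ]
    ring

/-- The toggle moves every permutation (the canonical cycle is not the identity). [folklore] -/
theorem toggle_ne_self {j : Fin N} (hj : j ∈ periodicPts (succMap t)) (hfix : succMap t j ≠ j)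
    (σ : Perm (Fin N)) : ValiantsHypothesis.toggle t j σ ≠ σ := by
  have hne : orbitPerm t j ≠ 1 := (isCycle_orbitPerm hj hfix).ne_one
  unfold ValiantsHypothesis.toggle
  split_ifs
  · rwa [Ne, mul_eq_left]
  · rwa [Ne, mul_eq_left, inv_eq_one]

/-- **The inner sum vanishes at a non-arborescence.** [folklore] -/
theorem sum_compatible_eq_zero {A : Type*} [CommRing A] (ht : ¬ IsArborescence t) :
    ∑ σ ∈ univ.filter (Compatible · t), (-1 : A) ^ σ.cycleFactorsFinset.card = 0 := by
  by_cases hloop : ∃ i, t i = some i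
  · obtain ⟨i, hi⟩ := hloop
    rw [Finset.sum_eq_zero]
    intro σ hσ
    exact absurd (Finset.mem_filter.1 hσ).2 (not_compatible_of_loop hi)
  · simp only [not_exists] at hloop
    obtain ⟨j, hj, hfix⟩ := exists_periodicPt hloop ht
    refine Finset.sum_involution (fun σ _ => ValiantsHypothesis.toggle t j σ) ?_ ?_ ?_ ?_
    · intro σ hσ
      rw [(Finset.mem_filter.1 hσ).2.neg_one_pow_toggle hj hfix, add_neg_cancel]
    · intro σ _ _
      exact toggle_ne_self hj hfix σ
    · intro σ hσ
      exact Finset.mem_filter.2 ⟨Finset.mem_univ _, (Finset.mem_filter.1 hσ).2.toggle hj hfix⟩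
    · intro σ hσ
      exact (Finset.mem_filter.1 hσ).2.toggle_toggle hj hfix

/-- **The inner sum at an arborescence is `1`** (only the identity is compatible). [folklore] -/
theorem sum_compatible_eq_one {A : Type*} [CommRing A] (ht : IsArborescence t) :
    ∑ σ ∈ univ.filter (Compatible · t), (-1 : A) ^ σ.cycleFactorsFinset.card = 1 := by
  have h : univ.filter (Compatible · t) = {1} := by
    ext σ
    simp only [Finset.mem_filter, Finset.mem_univ, true_and, Finset.mem_singleton]
    refine ⟨fun hc => hc.eq_one ht, ?_⟩
    rintro rfl
    exact compatible_one_iff.2 fun i hi => not_isArborescence_of_loop hi ht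
  rw [h, Finset.sum_singleton, Perm.cycleFactorsFinset_one, Finset.card_empty, pow_zero]

end Involution

/-! ### The theorem -/

section MatrixTree

variable (R : Type u) [CommRing R] (N : ℕ)

open Classical in
/-- **Directed matrix-tree theorem for the complete graph (Tutte; Moon 1970), for Jerrum–Snir's
spanning tree polynomial**: the determinant of the reduced Laplacian with generic edge weights is
the generating polynomial of the arborescences rooted at the root,
`det (stLaplacian R N) = stPoly R N = Σ_{t arborescence} Π_i x_{(i, t i)}` — "the same polynomial
can be expressed as an `n × n` determinant whose elements are linear combinations of the
indeterminates [13]". [cite: JerrumSnir1982, §5.1] -/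
theorem det_stLaplacian : (stLaplacian R N).det = stPoly R N := by
  rw [det_stLaplacian_eq_sum, stPoly, Finset.sum_filter]
  refine Finset.sum_congr rfl fun t _ => ?_
  by_cases ht : IsArborescence t
  · rw [sum_compatible_eq_one ht, one_mul, if_pos ht]
  · rw [sum_compatible_eq_zero ht, zero_mul, if_neg ht]

end MatrixTree

/-! ### Cayley's formula for rooted directed trees (Moon 1970), by evaluation at `x = 1` -/

section Cayley

variable (N : ℕ)

open Classical in
/-- **The number of arborescences of the complete graph on `N + 1` nodes with a fixed root is
`(N + 1)^{N - 1}`** (Cayley; the count `|mon(ST_{n×n})| = n^{n-2}`, `n = N + 1`, that Jerrum–Snir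
take from Moon [13]). Proof: evaluate `det_stLaplacian` at `x_{(i,v)} = 1` over `ℚ`; the
Laplacian becomes `(N+1)·I - J`, whose determinant is `(N+1)^N (1 - N/(N+1))` by the matrix
determinant lemma. (For `N = 0` both sides are `1`.) [cite: JerrumSnir1982, §4.5] -/
theorem card_filter_isArborescence :
    (univ.filter (IsArborescence (N := N))).card = (N + 1) ^ (N - 1) := by
  set φ : MvPolynomial (Fin N × Option (Fin N)) ℚ →+* ℚ := MvPolynomial.eval fun _ => (1 : ℚ)
    with hφ
  have hN : (N : ℚ) + 1 ≠ 0 := by positivity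
  have h1 : φ (stPoly ℚ N) = ((univ.filter (IsArborescence (N := N))).card : ℚ) := by
    simp [hφ, stPoly, map_sum, map_prod]
  have hM : φ.mapMatrix (stLaplacian ℚ N) =
      ((N : ℚ) + 1) • (1 + Matrix.replicateCol Unit (fun _ : Fin N => -(1 / ((N : ℚ) + 1))) *
        Matrix.replicateRow Unit (fun _ : Fin N => (1 : ℚ))) := by
    ext i j
    by_cases hij : i = j
    · subst hij
      simp [hφ, stLaplacian, Matrix.mul_apply, Matrix.replicateCol, Matrix.replicateRow]
      field_simp
      ring
    · simp [hφ, stLaplacian, hij, Matrix.mul_apply, Matrix.replicateCol, Matrix.replicateRow,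
        Matrix.one_apply_ne hij]
      field_simp
  have h2 : φ (stLaplacian ℚ N).det = ((N : ℚ) + 1) ^ N * (1 - N / ((N : ℚ) + 1)) := by
    rw [RingHom.map_det, hM, Matrix.det_smul, Fintype.card_fin,
      Matrix.det_one_add_replicateCol_mul_replicateRow]
    congr 1
    simp [dotProduct]
    ring
  have key : (((N + 1) ^ (N - 1) : ℕ) : ℚ) = ((N : ℚ) + 1) ^ N * (1 - N / ((N : ℚ) + 1)) := by
    cases N with
    | zero => norm_num
    | succ n =>
      rw [Nat.add_sub_cancel, pow_succ]
      push_cast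
      field_simp
      ring
  have h := congrArg φ (det_stLaplacian ℚ N)
  rw [h2, h1, ← key] at h
  exact_mod_cast h.symm

end Cayley

end Literature.Barriers.ValiantsHypothesis
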